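import Summits.QuantumFields.BalabanUV.T4Continuum.Support.NE7K1LinConjW

/-!
# NE7K1LinSchurLineDerivRelW — row NE7 (node U5), candidate route HOM, path H1L, cell K1-lin(s): the WEIGHTED `∂_s` LETTER IN
# FORM-RELATIVE CURRENCY (abstract) — `‖e^{θ}·((L(s)⁻¹ − L(t)⁻¹)g)‖ ≤ |t−s|·C·‖e^{θ}·g‖` with `C = 4K∕(c₁σ) + 2κ(4∕(c₁σ) + 8∕σ²)`
# from the two-run comparability AND bilinear conjugation-error bounds relative to `P₀`'s energy — the abstract face of (π6)

Lineage `b2b-balaban-t4-ne7-p2` (CRUX PROVER NE7 #2), generation 64; companion of `NE7K1LinSchurLineDerivRel` (unweighted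
form-relative letter) answering lens 1's precision (π6) (idea-1 g26, HOME/INBOX l.13091): «the (π1) object is the DECAY of −G(s)DG(s)
with s- AND mesh-free constants; (H2) runs verbatim on the e^{ρ}-conjugated line given (i) an ENERGY form of the Combes–Thomas step and
(ii) a form-relative bound of e^{ρ_c}De^{−ρ_c} against P₀».  THIS FILE proves exactly that, abstractly ([folklore], real symmetric
matrices), with (i) derived and (ii) taken as hypotheses on the two endpoints `P₀`, `P₁`:

* kit `NE7K1LinConjW`: the conjugated matrix `conjW θ M = (e^{θ_j−θ_k}M_{jk})` and (i) THE ENERGY FORM OF COMBES–THOMAS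
  (`energy_of_conj_inv`: `‖x‖² ≤ 4‖v‖²∕σ²` AND `⟨x,Lx⟩ ≤ 4‖v‖²∕σ` for `x = (conjW θ L)⁻¹v` — the energy is KEPT, not spent);
* **`inv_line_sub_inv_line_weighted`**: `P₀, P₁` symmetric and `σ`-coercive; quadratic conjugation errors at `θ` `≥ −(σ∕2)‖·‖²`;
  comparability `c₁⟨v,P₀v⟩ ≤ ⟨v,P₁v⟩`, `|⟨v,P₁v⟩ − ⟨v,P₀v⟩| ≤ K⟨v,P₀v⟩`; BILINEAR conjugation errors of `P₀` and of `P₁` at `θ` bounded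
  FORM-RELATIVELY: `|⟨z,(conjW θ P_i)u⟩ − ⟨z,P_iu⟩| ≤ κ(√⟨z,P₀z⟩·‖u‖ + ‖z‖·√⟨u,P₀u⟩ + ‖z‖‖u‖)`.  THEN for `s, t ∈ [0,1]` and every `g′`:
  `‖((conjW θ L(s))⁻¹ − (conjW θ L(t))⁻¹)g′‖² ≤ (t−s)²·C²·‖g′‖²`, `C = 4K∕(c₁σ) + 2κ(4∕(c₁σ) + 8∕σ²)` — NO operator norm, every
  constant as displayed (mesh-free whenever `σ, c₁, K, κ` are); **`wN_inv_line_sub_inv_line_le`**: the same in the weighted norm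
  `wN θ` of `NE7K1LinSchurLineDeriv` for `(L(s)⁻¹ − L(t)⁻¹)g`.
  Route: `w = G_θ(s)D_θu`, `u = G_θ(t)g′`, `z = G_{−θ}(s)w`; `‖w‖² = ⟨z,D_θu⟩ = ⟨z,Du⟩ + err_{P₁}(z,u) − err_{P₀}(z,u)`; the squeeze of
  `NE7K1LinSchurLineDerivRel` for `⟨z,Du⟩`; §2 for `⟨z,P₀z⟩ ≤ 4‖w‖²∕(c₁σ)`, `‖z‖² ≤ 4‖w‖²∕σ²` and the same for `u` against `g′`.

WHAT REMAINS FOR THE U = 1 INSTANCE (not here): the bilinear analogue of `NE7K1LinFineOpWeight.conjError_fineOpR_ge` for `P₀ = runA`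
(first-order error `≲ δ·(√E₀(z)‖u‖ + ‖z‖√E₀(u))`, second order `≲ δ²‖z‖‖u‖`, mesh-free in the canonical scaling), and for
`P₁ = S(H_B)` via `S(e^{ρ}He^{−ρ}) = e^{ρ_c}S(H)e^{−ρ_c}` and the harmonic-extension identity `⟨Ez, H E_ρu⟩ = ⟨z,P₁u⟩`.
HONEST FRAMING: [folklore] finite real matrices; nothing printed asserted; no `sorry`.  FIXED FINITE T⁴, rung (B)+1; NE7 NOT PRINTED ∕
NOT PROVED; spine 0∕9; NOT infinite volume, NOT mass gap, NOT Clay.  HONEST DEPENDENCY: continuum YM on T⁴ ⇐ BetaPertH ∧ nine spine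
estimates (0/9 proved); BetaPertH ⇐ (D1) ∧ (D4) ∧ CAP+tail; G-an2-4 gates asym, D1 and NE2/3/4.
-/

noncomputable section

open Finset Matrix

namespace Summit.QuantumFields.BalabanUV.T4Continuum.NE7K1LinSchurLineDerivRelW

open NE7K1LinSchurLineForm NE7K1LinSchurLineDeriv NE7K1LinSchurLineDerivRel NE7K1LinConjW

variable {ι : Type*} [Fintype ι] [DecidableEq ι]

set_option maxHeartbeats 800000 in
/-- **THE WEIGHTED `∂_s` LETTER IN FORM-RELATIVE CURRENCY (abstract face of (π6)).**  See the module docstring for the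
hypotheses; conclusion: `‖((conjW θ L(s))⁻¹ − (conjW θ L(t))⁻¹)g′‖² ≤ (t−s)²·C²·‖g′‖²`, `C = 4K∕(c₁σ) + 2κ(4∕(c₁σ) + 8∕σ²)`,
`L(r) = (1−r)P₀ + rP₁` (heartbeats raised: one long chain of elementary estimates). [folklore] -/
theorem inv_line_sub_inv_line_weighted (θ : ι → ℝ) (P₀ P₁ : Matrix ι ι ℝ) (h0s : P₀.IsSymm) (h1s : P₁.IsSymm)
    {σ c₁ K κ : ℝ} (hσ : 0 < σ) (hc₁ : 0 < c₁) (hc₁' : c₁ ≤ 1) (hK : 0 < K) (hκ : 0 ≤ κ)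
    (hP₀ : ∀ v, σ * (v ⬝ᵥ v) ≤ v ⬝ᵥ P₀.mulVec v) (hP₁ : ∀ v, σ * (v ⬝ᵥ v) ≤ v ⬝ᵥ P₁.mulVec v)
    (he₀ : ∀ w, -(σ / 2) * (w ⬝ᵥ w) ≤ w ⬝ᵥ (conjW θ P₀).mulVec w - w ⬝ᵥ P₀.mulVec w)
    (he₁ : ∀ w, -(σ / 2) * (w ⬝ᵥ w) ≤ w ⬝ᵥ (conjW θ P₁).mulVec w - w ⬝ᵥ P₁.mulVec w)
    (hlow : ∀ v, c₁ * (v ⬝ᵥ P₀.mulVec v) ≤ v ⬝ᵥ P₁.mulVec v)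
    (hup : ∀ v, v ⬝ᵥ P₁.mulVec v - v ⬝ᵥ P₀.mulVec v ≤ K * (v ⬝ᵥ P₀.mulVec v))
    (hlo : ∀ v, v ⬝ᵥ P₀.mulVec v - v ⬝ᵥ P₁.mulVec v ≤ K * (v ⬝ᵥ P₀.mulVec v))
    (hb₀ : ∀ z u, |z ⬝ᵥ (conjW θ P₀).mulVec u - z ⬝ᵥ P₀.mulVec u| ≤
      κ * (Real.sqrt (z ⬝ᵥ P₀.mulVec z) * Real.sqrt (u ⬝ᵥ u) + Real.sqrt (z ⬝ᵥ z) * Real.sqrt (u ⬝ᵥ P₀.mulVec u) +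
        Real.sqrt (z ⬝ᵥ z) * Real.sqrt (u ⬝ᵥ u)))
    (hb₁ : ∀ z u, |z ⬝ᵥ (conjW θ P₁).mulVec u - z ⬝ᵥ P₁.mulVec u| ≤
      κ * (Real.sqrt (z ⬝ᵥ P₀.mulVec z) * Real.sqrt (u ⬝ᵥ u) + Real.sqrt (z ⬝ᵥ z) * Real.sqrt (u ⬝ᵥ P₀.mulVec u) +
        Real.sqrt (z ⬝ᵥ z) * Real.sqrt (u ⬝ᵥ u)))
    {s t : ℝ} (hs0 : 0 ≤ s) (hs1 : s ≤ 1) (ht0 : 0 ≤ t) (ht1 : t ≤ 1) (g : ι → ℝ) :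
    ((conjW θ ((1 - s) • P₀ + s • P₁))⁻¹ - (conjW θ ((1 - t) • P₀ + t • P₁))⁻¹).mulVec g ⬝ᵥ
        ((conjW θ ((1 - s) • P₀ + s • P₁))⁻¹ - (conjW θ ((1 - t) • P₀ + t • P₁))⁻¹).mulVec g ≤
      (t - s) ^ 2 * (4 * K / (c₁ * σ) + 2 * κ * (4 / (c₁ * σ) + 8 / σ ^ 2)) ^ 2 * (g ⬝ᵥ g) := by
  -- abbreviations
  set Ls : Matrix ι ι ℝ := (1 - s) • P₀ + s • P₁ with hLs
  set Lt : Matrix ι ι ℝ := (1 - t) • P₀ + t • P₁ with hLt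
  set D : Matrix ι ι ℝ := P₁ - P₀ with hDdef
  have nn : ∀ v : ι → ℝ, 0 ≤ v ⬝ᵥ v := fun v => by
    simp only [dotProduct]; exact Finset.sum_nonneg fun _ _ => mul_self_nonneg _
  have hP₀nn : ∀ v, 0 ≤ v ⬝ᵥ P₀.mulVec v := fun v => le_trans (mul_nonneg hσ.le (nn v)) (hP₀ v)
  -- the lines: coercive, symmetric; their conjugates: linear in the endpoints, quadratic error ≥ −σ/2
  have hcoer : ∀ {r : ℝ}, 0 ≤ r → r ≤ 1 → ∀ v, σ * (v ⬝ᵥ v) ≤ v ⬝ᵥ ((1 - r) • P₀ + r • P₁).mulVec v :=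
    fun hr0 hr1 => coercive_line P₀ P₁ hP₀ hP₁ hr0 hr1
  have hsymmL : ∀ r : ℝ, ((1 - r) • P₀ + r • P₁).IsSymm := fun r => (h0s.smul (1 - r)).add (h1s.smul r)
  have hconjL : ∀ (θ' : ι → ℝ) (r : ℝ), conjW θ' ((1 - r) • P₀ + r • P₁) = (1 - r) • conjW θ' P₀ + r • conjW θ' P₁ :=
    fun θ' r => by rw [conjW_add, conjW_smul, conjW_smul]
  have herrL : ∀ {r : ℝ}, 0 ≤ r → r ≤ 1 → ∀ w,
      -(σ / 2) * (w ⬝ᵥ w) ≤ w ⬝ᵥ (conjW θ ((1 - r) • P₀ + r • P₁)).mulVec w - w ⬝ᵥ ((1 - r) • P₀ + r • P₁).mulVec w := by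
    intro r hr0 hr1 w
    have e0 := he₀ w; have e1 := he₁ w
    rw [hconjL]
    simp only [add_mulVec, smul_mulVec, dotProduct_add, dotProduct_smul, smul_eq_mul]
    have a0 := mul_le_mul_of_nonneg_left e0 (by linarith : (0 : ℝ) ≤ 1 - r)
    have a1 := mul_le_mul_of_nonneg_left e1 hr0
    nlinarith [nn w, a0, a1]
  -- the same at `−θ` (quadratic forms agree)
  have herrL' : ∀ {r : ℝ}, 0 ≤ r → r ≤ 1 → ∀ w,
      -(σ / 2) * (w ⬝ᵥ w) ≤ w ⬝ᵥ (conjW (-θ) ((1 - r) • P₀ + r • P₁)).mulVec w - w ⬝ᵥ ((1 - r) • P₀ + r • P₁).mulVec w := by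
    intro r hr0 hr1 w
    rw [form_conjW_neg _ _ (hsymmL r)]
    exact herrL hr0 hr1 w
  -- (a) the three vectors
  have hEt := energy_of_conj_inv θ Lt hσ (hcoer ht0 ht1) (herrL ht0 ht1)
  have hEs := energy_of_conj_inv θ Ls hσ (hcoer hs0 hs1) (herrL hs0 hs1)
  have hEs' := energy_of_conj_inv (-θ) Ls hσ (hcoer hs0 hs1) (herrL' hs0 hs1)
  have hdet_t : IsUnit (conjW θ Lt).det := (hEt g).1
  have hdet_s : IsUnit (conjW θ Ls).det := (hEs g).1
  set u : ι → ℝ := (conjW θ Lt)⁻¹.mulVec g with hu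
  set w : ι → ℝ := (conjW θ Ls)⁻¹.mulVec ((conjW θ D).mulVec u) with hw
  set z : ι → ℝ := (conjW (-θ) Ls)⁻¹.mulVec w with hz
  -- (b) the identity `(G_θ(s) − G_θ(t))g = (t−s)•w`
  have hsub : conjW θ Lt - conjW θ Ls = (t - s) • conjW θ D := by
    rw [hconjL, hconjL, hDdef, conjW_sub]
    simp only [smul_sub, sub_smul, one_smul]
    abel
  have hident : ((conjW θ Ls)⁻¹ - (conjW θ Lt)⁻¹).mulVec g = (t - s) • w := by
    have key : (conjW θ Ls)⁻¹ * (conjW θ Lt - conjW θ Ls) * (conjW θ Lt)⁻¹ = (conjW θ Ls)⁻¹ - (conjW θ Lt)⁻¹ := by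
      rw [Matrix.mul_sub, Matrix.sub_mul, Matrix.mul_assoc _ (conjW θ Lt), mul_nonsing_inv _ hdet_t, Matrix.mul_one,
        nonsing_inv_mul _ hdet_s, Matrix.one_mul]
    rw [← key, hsub, Matrix.mul_smul, Matrix.smul_mul, smul_mulVec, ← mulVec_mulVec, ← mulVec_mulVec]
  -- (c) `‖w‖² = ⟨z, (conjW θ D)u⟩` via the transpose `(conjW θ Ls)ᵀ = conjW (−θ) Ls`
  have hT : (conjW θ Ls)ᵀ = conjW (-θ) Ls := by rw [conjW_transpose, (hsymmL s).eq]
  have hww : w ⬝ᵥ w = z ⬝ᵥ (conjW θ D).mulVec u := by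
    have h1 : w ⬝ᵥ w = w ⬝ᵥ (conjW θ Ls)⁻¹.mulVec ((conjW θ D).mulVec u) := by rw [hw]
    rw [h1, dotProduct_mulVec, ← mulVec_transpose, transpose_nonsing_inv, hT, ← hz]
  -- (d) split `⟨z,(conjW θ D)u⟩ = ⟨z,Du⟩ + err₁ − err₀`
  have hsplit : z ⬝ᵥ (conjW θ D).mulVec u = z ⬝ᵥ D.mulVec u +
      ((z ⬝ᵥ (conjW θ P₁).mulVec u - z ⬝ᵥ P₁.mulVec u) - (z ⬝ᵥ (conjW θ P₀).mulVec u - z ⬝ᵥ P₀.mulVec u)) := by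
    rw [hDdef, conjW_sub, sub_mulVec, sub_mulVec, dotProduct_sub, dotProduct_sub]; ring
  -- (e) sizes: A² = ‖w‖², B² = ‖g‖²; energies and norms of z, u
  have hzz : z ⬝ᵥ z ≤ 4 * (w ⬝ᵥ w) / σ ^ 2 := (hEs' w).2.1
  have hEz' : z ⬝ᵥ Ls.mulVec z ≤ 4 * (w ⬝ᵥ w) / σ := (hEs' w).2.2
  have huu : u ⬝ᵥ u ≤ 4 * (g ⬝ᵥ g) / σ ^ 2 := (hEt g).2.1
  have hEu' : u ⬝ᵥ Lt.mulVec u ≤ 4 * (g ⬝ᵥ g) / σ := (hEt g).2.2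
  have hEz : z ⬝ᵥ P₀.mulVec z ≤ 4 * (w ⬝ᵥ w) / (c₁ * σ) := by
    have h := rel_energy_line P₀ P₁ hc₁' hP₀nn hlow hs0 hs1 z
    rw [← hLs] at h
    have h3 : c₁ * (z ⬝ᵥ P₀.mulVec z) * σ ≤ 4 * (w ⬝ᵥ w) := by
      have := mul_le_mul_of_nonneg_right (h.trans hEz') hσ.le
      rwa [div_mul_cancel₀ _ hσ.ne'] at this
    rw [le_div_iff₀ (by positivity)]
    calc z ⬝ᵥ P₀.mulVec z * (c₁ * σ) = c₁ * (z ⬝ᵥ P₀.mulVec z) * σ := by ring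
      _ ≤ 4 * (w ⬝ᵥ w) := h3
  have hEu : u ⬝ᵥ P₀.mulVec u ≤ 4 * (g ⬝ᵥ g) / (c₁ * σ) := by
    have h := rel_energy_line P₀ P₁ hc₁' hP₀nn hlow ht0 ht1 u
    rw [← hLt] at h
    have h3 : c₁ * (u ⬝ᵥ P₀.mulVec u) * σ ≤ 4 * (g ⬝ᵥ g) := by
      have := mul_le_mul_of_nonneg_right (h.trans hEu') hσ.le
      rwa [div_mul_cancel₀ _ hσ.ne'] at this
    rw [le_div_iff₀ (by positivity)]
    calc u ⬝ᵥ P₀.mulVec u * (c₁ * σ) = c₁ * (u ⬝ᵥ P₀.mulVec u) * σ := by ring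
      _ ≤ 4 * (g ⬝ᵥ g) := h3
  -- square roots: A = √‖w‖², B = √‖g‖²; a₁ = 4/(c₁σ), a₂ = 4/σ²
  set A := Real.sqrt (w ⬝ᵥ w) with hA
  set B := Real.sqrt (g ⬝ᵥ g) with hB
  have hA0 : 0 ≤ A := Real.sqrt_nonneg _
  have hB0 : 0 ≤ B := Real.sqrt_nonneg _
  have hAA : A ^ 2 = w ⬝ᵥ w := Real.sq_sqrt (nn w)
  have hBB : B ^ 2 = g ⬝ᵥ g := Real.sq_sqrt (nn g)
  clear_value A B
  have ha₁ : 0 ≤ 4 / (c₁ * σ) := by positivity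
  have ha₂ : 0 ≤ 4 / σ ^ 2 := by positivity
  have hsEz : Real.sqrt (z ⬝ᵥ P₀.mulVec z) ≤ Real.sqrt (4 / (c₁ * σ)) * A :=
    sqrt_le_of_sq_le ha₁ hA0 (by rw [hAA, div_mul_eq_mul_div]; exact hEz)
  have hsEu : Real.sqrt (u ⬝ᵥ P₀.mulVec u) ≤ Real.sqrt (4 / (c₁ * σ)) * B :=
    sqrt_le_of_sq_le ha₁ hB0 (by rw [hBB, div_mul_eq_mul_div]; exact hEu)
  have hsz : Real.sqrt (z ⬝ᵥ z) ≤ Real.sqrt (4 / σ ^ 2) * A :=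
    sqrt_le_of_sq_le ha₂ hA0 (by rw [hAA, div_mul_eq_mul_div]; exact hzz)
  have hsu : Real.sqrt (u ⬝ᵥ u) ≤ Real.sqrt (4 / σ ^ 2) * B :=
    sqrt_le_of_sq_le ha₂ hB0 (by rw [hBB, div_mul_eq_mul_div]; exact huu)
  -- (f) the three terms against A·B
  have hupD : ∀ v, v ⬝ᵥ D.mulVec v ≤ K * (v ⬝ᵥ P₀.mulVec v) := fun v => by
    have := hup v; simp only [hDdef, sub_mulVec, dotProduct_sub]; linarith
  have hloD : ∀ v, -(v ⬝ᵥ D.mulVec v) ≤ K * (v ⬝ᵥ P₀.mulVec v) := fun v => by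
    have := hlo v; simp only [hDdef, sub_mulVec, dotProduct_sub]; linarith
  have hD_symm : D.IsSymm := h1s.sub h0s
  -- term 1: the squeeze, in product form `K·(4/(c₁σ))·A·B`
  have hT1 : |z ⬝ᵥ D.mulVec u| ≤ K * (4 / (c₁ * σ)) * A * B := by
    by_cases hA' : A = 0
    · -- then `w = 0`, so `z = 0` and the term vanishes
      have hw0 : w ⬝ᵥ w = 0 := by rw [← hAA, hA']; ring
      have hz0 : z ⬝ᵥ z = 0 := le_antisymm (by have := hzz; rw [hw0] at this; simpa using this) (nn z)
      have hz0' : z = 0 := by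
        funext i
        have : z i * z i ≤ z ⬝ᵥ z :=
          Finset.single_le_sum (f := fun j => z j * z j) (fun _ _ => mul_self_nonneg _) (Finset.mem_univ i)
        rw [hz0] at this
        exact mul_self_eq_zero.1 (le_antisymm this (mul_self_nonneg _))
      rw [hz0', zero_dotProduct, abs_zero, hA']
      simp
    · have hApos : 0 < A := lt_of_le_of_ne hA0 (Ne.symm hA')
      by_cases hB' : B = 0
      · -- then `g = 0`, so `u = 0`
        have hg0 : g ⬝ᵥ g = 0 := by rw [← hBB, hB']; ring
        have hu0 : u ⬝ᵥ u = 0 := le_antisymm (by have := huu; rw [hg0] at this; simpa using this) (nn u)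
        have hu0' : u = 0 := by
          funext i
          have : u i * u i ≤ u ⬝ᵥ u :=
            Finset.single_le_sum (f := fun j => u j * u j) (fun _ _ => mul_self_nonneg _) (Finset.mem_univ i)
          rw [hu0] at this
          exact mul_self_eq_zero.1 (le_antisymm this (mul_self_nonneg _))
        rw [hu0', mulVec_zero, dotProduct_zero, abs_zero, hB']
        simp
      · have hBpos : 0 < B := lt_of_le_of_ne hB0 (Ne.symm hB')
        have hlam : 0 < B / A := div_pos hBpos hApos
        have hsq := abs_dot_mulVec_le_of_squeeze P₀ D h0s hD_symm hupD hloD hlam z u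
        have h1 : B / A * (z ⬝ᵥ P₀.mulVec z) ≤ B / A * (4 / (c₁ * σ) * A ^ 2) := by
          refine mul_le_mul_of_nonneg_left ?_ hlam.le
          rw [hAA, div_mul_eq_mul_div]; exact hEz
        have h2 : (B / A)⁻¹ * (u ⬝ᵥ P₀.mulVec u) ≤ (B / A)⁻¹ * (4 / (c₁ * σ) * B ^ 2) := by
          refine mul_le_mul_of_nonneg_left ?_ (inv_nonneg.2 hlam.le)
          rw [hBB, div_mul_eq_mul_div]; exact hEu
        have e : K * (B / A * (4 / (c₁ * σ) * A ^ 2) + (B / A)⁻¹ * (4 / (c₁ * σ) * B ^ 2)) / 2 =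
            K * (4 / (c₁ * σ)) * A * B := by
          field_simp
          ring
        calc |z ⬝ᵥ D.mulVec u| ≤ K * (B / A * (z ⬝ᵥ P₀.mulVec z) + (B / A)⁻¹ * (u ⬝ᵥ P₀.mulVec u)) / 2 := hsq
          _ ≤ K * (B / A * (4 / (c₁ * σ) * A ^ 2) + (B / A)⁻¹ * (4 / (c₁ * σ) * B ^ 2)) / 2 := by
              have := mul_le_mul_of_nonneg_left (add_le_add h1 h2) hK.le; linarith
          _ = K * (4 / (c₁ * σ)) * A * B := e
  -- terms 2 and 3: the bilinear conjugation errors, `≤ κ(2√a₁√a₂ + a₂)·A·B ≤ κ(a₁ + 2a₂)·A·B`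
  have hmix : Real.sqrt (z ⬝ᵥ P₀.mulVec z) * Real.sqrt (u ⬝ᵥ u) + Real.sqrt (z ⬝ᵥ z) * Real.sqrt (u ⬝ᵥ P₀.mulVec u) +
      Real.sqrt (z ⬝ᵥ z) * Real.sqrt (u ⬝ᵥ u) ≤ (4 / (c₁ * σ) + 8 / σ ^ 2) * A * B := by
    have s1 := Real.sqrt_nonneg (z ⬝ᵥ P₀.mulVec z)
    have s2 := Real.sqrt_nonneg (u ⬝ᵥ u)
    have s3 := Real.sqrt_nonneg (z ⬝ᵥ z)
    have s4 := Real.sqrt_nonneg (u ⬝ᵥ P₀.mulVec u)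
    have r1 := Real.sqrt_nonneg (4 / (c₁ * σ))
    have r2 := Real.sqrt_nonneg (4 / σ ^ 2)
    have p1 : Real.sqrt (z ⬝ᵥ P₀.mulVec z) * Real.sqrt (u ⬝ᵥ u) ≤ (Real.sqrt (4 / (c₁ * σ)) * A) * (Real.sqrt (4 / σ ^ 2) * B) :=
      mul_le_mul hsEz hsu s2 (mul_nonneg r1 hA0)
    have p2 : Real.sqrt (z ⬝ᵥ z) * Real.sqrt (u ⬝ᵥ P₀.mulVec u) ≤ (Real.sqrt (4 / σ ^ 2) * A) * (Real.sqrt (4 / (c₁ * σ)) * B) :=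
      mul_le_mul hsz hsEu s4 (mul_nonneg r2 hA0)
    have p3 : Real.sqrt (z ⬝ᵥ z) * Real.sqrt (u ⬝ᵥ u) ≤ (Real.sqrt (4 / σ ^ 2) * A) * (Real.sqrt (4 / σ ^ 2) * B) :=
      mul_le_mul hsz hsu s2 (mul_nonneg r2 hA0)
    have q1 : Real.sqrt (4 / (c₁ * σ)) * Real.sqrt (4 / σ ^ 2) ≤ (4 / (c₁ * σ) + 4 / σ ^ 2) / 2 := by
      nlinarith [sq_nonneg (Real.sqrt (4 / (c₁ * σ)) - Real.sqrt (4 / σ ^ 2)), Real.sq_sqrt ha₁, Real.sq_sqrt ha₂]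
    have q2 : Real.sqrt (4 / σ ^ 2) * Real.sqrt (4 / σ ^ 2) = 4 / σ ^ 2 := Real.mul_self_sqrt ha₂
    have hAB : 0 ≤ A * B := mul_nonneg hA0 hB0
    calc Real.sqrt (z ⬝ᵥ P₀.mulVec z) * Real.sqrt (u ⬝ᵥ u) + Real.sqrt (z ⬝ᵥ z) * Real.sqrt (u ⬝ᵥ P₀.mulVec u) +
          Real.sqrt (z ⬝ᵥ z) * Real.sqrt (u ⬝ᵥ u)
        ≤ (Real.sqrt (4 / (c₁ * σ)) * A) * (Real.sqrt (4 / σ ^ 2) * B) + (Real.sqrt (4 / σ ^ 2) * A) * (Real.sqrt (4 / (c₁ * σ)) * B) +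
          (Real.sqrt (4 / σ ^ 2) * A) * (Real.sqrt (4 / σ ^ 2) * B) := add_le_add (add_le_add p1 p2) p3
      _ = (2 * (Real.sqrt (4 / (c₁ * σ)) * Real.sqrt (4 / σ ^ 2)) + Real.sqrt (4 / σ ^ 2) * Real.sqrt (4 / σ ^ 2)) * (A * B) := by
          ring
      _ ≤ (2 * ((4 / (c₁ * σ) + 4 / σ ^ 2) / 2) + 4 / σ ^ 2) * (A * B) :=
          mul_le_mul_of_nonneg_right (by linarith [q1, q2.le, q2.ge]) hAB
      _ = (4 / (c₁ * σ) + 8 / σ ^ 2) * A * B := by ring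
  have hT2 := (hb₁ z u).trans (mul_le_mul_of_nonneg_left hmix hκ)
  have hT3 := (hb₀ z u).trans (mul_le_mul_of_nonneg_left hmix hκ)
  -- (g) `A² ≤ C·A·B`, hence `A² ≤ C²·B²`
  set C : ℝ := 4 * K / (c₁ * σ) + 2 * κ * (4 / (c₁ * σ) + 8 / σ ^ 2) with hC
  have hC0 : 0 ≤ C := by positivity
  have hA2 : A ^ 2 ≤ C * A * B := by
    rw [hAA, hww, hsplit]
    have habs := abs_add_le (z ⬝ᵥ D.mulVec u)
      ((z ⬝ᵥ (conjW θ P₁).mulVec u - z ⬝ᵥ P₁.mulVec u) - (z ⬝ᵥ (conjW θ P₀).mulVec u - z ⬝ᵥ P₀.mulVec u))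
    have habs2 := abs_sub (z ⬝ᵥ (conjW θ P₁).mulVec u - z ⬝ᵥ P₁.mulVec u)
      (z ⬝ᵥ (conjW θ P₀).mulVec u - z ⬝ᵥ P₀.mulVec u)
    have hle := le_abs_self (z ⬝ᵥ D.mulVec u + ((z ⬝ᵥ (conjW θ P₁).mulVec u - z ⬝ᵥ P₁.mulVec u) -
      (z ⬝ᵥ (conjW θ P₀).mulVec u - z ⬝ᵥ P₀.mulVec u)))
    have : |z ⬝ᵥ D.mulVec u| + (|z ⬝ᵥ (conjW θ P₁).mulVec u - z ⬝ᵥ P₁.mulVec u| +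
        |z ⬝ᵥ (conjW θ P₀).mulVec u - z ⬝ᵥ P₀.mulVec u|) ≤ C * A * B := by
      rw [hC]
      have := add_le_add hT1 (add_le_add hT2 hT3)
      refine this.trans (le_of_eq ?_)
      ring
    linarith
  have hfinal : w ⬝ᵥ w ≤ C ^ 2 * (g ⬝ᵥ g) := by
    rw [← hAA, ← hBB]
    by_cases hA' : A = 0
    · rw [hA', zero_pow two_ne_zero]; positivity
    · have hApos : 0 < A := lt_of_le_of_ne hA0 (Ne.symm hA')
      have h0 : A * A ≤ C * B * A := by
        calc A * A = A ^ 2 := (sq A).symm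
          _ ≤ C * A * B := hA2
          _ = C * B * A := by ring
      have h1 : A ≤ C * B := le_of_mul_le_mul_right h0 hApos
      calc A ^ 2 ≤ (C * B) ^ 2 := pow_le_pow_left₀ hA0 h1 2
        _ = C ^ 2 * B ^ 2 := by ring
  -- (h) assemble
  rw [hident, smul_dotProduct, dotProduct_smul, smul_eq_mul, smul_eq_mul]
  have hts : 0 ≤ (t - s) ^ 2 := sq_nonneg _
  calc (t - s) * ((t - s) * (w ⬝ᵥ w)) = (t - s) ^ 2 * (w ⬝ᵥ w) := by ring
    _ ≤ (t - s) ^ 2 * (C ^ 2 * (g ⬝ᵥ g)) := mul_le_mul_of_nonneg_left hfinal hts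
    _ = (t - s) ^ 2 * C ^ 2 * (g ⬝ᵥ g) := by ring

/-- **THE SAME IN THE WEIGHTED NORM OF THE ORIGINAL LINE**: `wN θ ((L(s)⁻¹ − L(t)⁻¹)g) ≤ (t−s)²·C²·wN θ g` — the weighted
`∂_s` letter with every constant as displayed (`wN θ v = ‖e^{θ}v‖²` of `NE7K1LinSchurLineDeriv`). [folklore] -/
theorem wN_inv_line_sub_inv_line_le (θ : ι → ℝ) (P₀ P₁ : Matrix ι ι ℝ) (h0s : P₀.IsSymm) (h1s : P₁.IsSymm)
    {σ c₁ K κ : ℝ} (hσ : 0 < σ) (hc₁ : 0 < c₁) (hc₁' : c₁ ≤ 1) (hK : 0 < K) (hκ : 0 ≤ κ)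
    (hP₀ : ∀ v, σ * (v ⬝ᵥ v) ≤ v ⬝ᵥ P₀.mulVec v) (hP₁ : ∀ v, σ * (v ⬝ᵥ v) ≤ v ⬝ᵥ P₁.mulVec v)
    (he₀ : ∀ w, -(σ / 2) * (w ⬝ᵥ w) ≤ w ⬝ᵥ (conjW θ P₀).mulVec w - w ⬝ᵥ P₀.mulVec w)
    (he₁ : ∀ w, -(σ / 2) * (w ⬝ᵥ w) ≤ w ⬝ᵥ (conjW θ P₁).mulVec w - w ⬝ᵥ P₁.mulVec w)
    (hlow : ∀ v, c₁ * (v ⬝ᵥ P₀.mulVec v) ≤ v ⬝ᵥ P₁.mulVec v)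
    (hup : ∀ v, v ⬝ᵥ P₁.mulVec v - v ⬝ᵥ P₀.mulVec v ≤ K * (v ⬝ᵥ P₀.mulVec v))
    (hlo : ∀ v, v ⬝ᵥ P₀.mulVec v - v ⬝ᵥ P₁.mulVec v ≤ K * (v ⬝ᵥ P₀.mulVec v))
    (hb₀ : ∀ z u, |z ⬝ᵥ (conjW θ P₀).mulVec u - z ⬝ᵥ P₀.mulVec u| ≤
      κ * (Real.sqrt (z ⬝ᵥ P₀.mulVec z) * Real.sqrt (u ⬝ᵥ u) + Real.sqrt (z ⬝ᵥ z) * Real.sqrt (u ⬝ᵥ P₀.mulVec u) +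
        Real.sqrt (z ⬝ᵥ z) * Real.sqrt (u ⬝ᵥ u)))
    (hb₁ : ∀ z u, |z ⬝ᵥ (conjW θ P₁).mulVec u - z ⬝ᵥ P₁.mulVec u| ≤
      κ * (Real.sqrt (z ⬝ᵥ P₀.mulVec z) * Real.sqrt (u ⬝ᵥ u) + Real.sqrt (z ⬝ᵥ z) * Real.sqrt (u ⬝ᵥ P₀.mulVec u) +
        Real.sqrt (z ⬝ᵥ z) * Real.sqrt (u ⬝ᵥ u)))
    {s t : ℝ} (hs0 : 0 ≤ s) (hs1 : s ≤ 1) (ht0 : 0 ≤ t) (ht1 : t ≤ 1) (g : ι → ℝ) :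
    wN θ ((((1 - s) • P₀ + s • P₁)⁻¹ - ((1 - t) • P₀ + t • P₁)⁻¹).mulVec g) ≤
      (t - s) ^ 2 * (4 * K / (c₁ * σ) + 2 * κ * (4 / (c₁ * σ) + 8 / σ ^ 2)) ^ 2 * wN θ g := by
  have hdet_s : IsUnit ((1 - s) • P₀ + s • P₁).det := isUnit_det_of_coercive _ hσ (coercive_line P₀ P₁ hP₀ hP₁ hs0 hs1)
  have hdet_t : IsUnit ((1 - t) • P₀ + t • P₁).det := isUnit_det_of_coercive _ hσ (coercive_line P₀ P₁ hP₀ hP₁ ht0 ht1)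
  have hW : (fun i => Real.exp (θ i) * ((((1 - s) • P₀ + s • P₁)⁻¹ - ((1 - t) • P₀ + t • P₁)⁻¹).mulVec g) i) =
      ((conjW θ ((1 - s) • P₀ + s • P₁))⁻¹ - (conjW θ ((1 - t) • P₀ + t • P₁))⁻¹).mulVec
        (fun i => Real.exp (θ i) * g i) := by
    rw [← conjW_inv θ _ hdet_s, ← conjW_inv θ _ hdet_t, ← conjW_sub, conjW_mulVec_weight]
  rw [wN_eq_dot, wN_eq_dot, hW]
  exact inv_line_sub_inv_line_weighted θ P₀ P₁ h0s h1s hσ hc₁ hc₁' hK hκ hP₀ hP₁ he₀ he₁ hlow hup hlo hb₀ hb₁ hs0 hs1 ht0 ht1 _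

end Summit.QuantumFields.BalabanUV.T4Continuum.NE7K1LinSchurLineDerivRelW
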